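import Literature.NumberTheory.EllipticCurves.Rank1Residual.X12CubeSumTransport
import Literature.NumberTheory.EllipticCurves.GlobalMinimalModelProofs
import HarnessLib

/-!
# X12 at `p = 3`, cube-sum corner: the three published FAMILY theorems as ISOGENY-CLASS theorems (partner model discharged)

HONEST FRAMING (cell `b2b-bsdres`, run/shared/lean/b2b/bsd-rank1-residual/; harvest seat
`b2b-bsdres-harvest-1`, gen 24): prove what is provable now; shrink each hard class to its core
with data; no claim beyond stated classes. The cell deletes the COMBINATION-SHAPED residual classes
of the BSD formula in analytic rank `≤ 1` from PUBLISHED theorems only and TYPES the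
construction-shaped ones; this is not "finishing BSD". Class X12 (CM, rank `1`, `p ∣ 6·d_K·N`,
`p` not split) stays CONSTRUCTION-SHAPED; the family theorems below are density-zero sub-families
of its ramified corner `K = ℚ(√−3)`, `p = 3` (referee R65.1: family theorems are per-curve tools,
no label change). Theorems only: NO new named fact, no definition; net Literature debt `0`. The
thirteen explicit records are in the sibling file `X12/CubeSumFamiliesRecords.lean`.

## What is new relative to gen 2 / gen 3

The three vendored family facts — Kezuka–Li 2020 Cor. 1.2 (`KezukaLi2020.cor12_threePart_of_cubeSum`),
Hu–Shu–Yin 2019 Thm. 1.4 (`HuShuYin2019.thm14_threePart_product`), Shu–Yin 2022 Thm. 1.2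
(`ShuYin2022.thm12_threePart_product`) — are stated for "any globally minimal model `ℚ`-isomorphic
to the printed equation", and the two PRODUCT formulas moreover ask for a globally minimal model
`A` of the rank-zero PARTNER curve (`E_{3p²}`, resp. `E_p` / `E_{p²}`), which the Literature
consumers `bsdp_three_of_thm14` / `bsdp_three_of_thm12_two/five` carry as a binder ("supplying it
is the lane's certificate"), and which gen 3 (`Rank1Residual/X12CubeSumTransport.lean`) supplied
by kernel-deciding the minimality of four explicit partner equations (11907o2, 41067h2, 449307k2,
225b2). Here:

1. **The partner binder is discharged once and for all by EXISTENCE** (`exists_isGloballyMinimal_model`: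
   Néron / Silverman *AEC* VIII.8.3 over `ℚ`, tree theorem `hasGlobalMinimalModel_rat_holds`, applied
   to the partner's printed equation, which is elliptic): `A` enters the facts only universally
   quantified, so any globally minimal model serves and one exists. Consumers
   `bsdp_three_of_thm14'`, `bsdp_three_of_thm12_two'`, `bsdp_three_of_thm12_five'` = the Literature
   consumers minus the binder `hA`.
2. **Isogeny-class form.** For every parameter in the printed range and EVERY globally minimal
   `V/ℚ` that is `ℚ`-ISOGENOUS to the family's equation: `r_an(V) = 1 ∧ BSD(V, 3)`
   (`bsdp_three_of_isIsogenous_cubeSumTwoModel`, `…_sylvester`, `…_cubeSum_three_mul_sq`,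
   `…_cubeSum_three_mul`) — the family fact on an (existentially supplied) globally minimal model of
   the printed equation, then Cassels' isogeny invariance of the BSD quotient
   (`bsdRHS_eq_of_isIsogenous`, through gen 3's `X12CubeSum.bsdp_three_of_isIsogenous`, with
   modularity for `L'(E,1) ≠ 0` and `r_an` an isogeny invariant). For Shu–Yin, whose print gives
   `|Ш[3^∞]| = 1` but not the finiteness of `Ш`, the transport takes Gross–Zagier–Kolyvagin
   (`rank_eq_analyticRank_of_analyticRank_le_one`) for `Ш` finite at analytic rank one — exactly as
   gen 3 did for 6075bc1. So a census pair `(E, 3)` in one of these isogeny classes needs ONE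
   per-curve datum: a `ℚ`-isogeny (or isomorphism) from its globally minimal model to the printed
   equation — no partner, no second minimality proof.
3. **The 13 beyond-window classes** (`2·10⁴ ≤ N < 5·10⁵`; sibling file
   `X12/CubeSumFamiliesRecords.lean`) which the planner census
   `HOME/b2b-bsdres-hyp/hyp/ram3/RAM3-CENSUS.md` §5 (two engines A ‖ P, 0 disagreements) lists as
   "published-shaped, every binder met" in the cube-sum school — Hu–Shu–Yin `n = 31, 79, 97, 223`;
   Kezuka–Li `n = 2·23², 2·29, 2·41², 2·47, 2·59²`; Shu–Yin `n = 3·11², 3·23, 3·29², 3·41` — get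
   kernel records `bsdp_three_cubeSum<n>`: for each, the integral equation `[0,0,a₃,0,a₆]`
   `ℚ`-isomorphic to the printed one (`halfScale`, or the identity for Kezuka–Li's (4.1)), its
   `IsElliptic` and `IsGloballyMinimal` instances DECIDED in the kernel by gen 3's
   `isGloballyMinimal_mk` (`3`-adic criterion at `3` for `c₄ = 0`, Silverman's `ord_q Δ < 12`
   elsewhere via `checkTwelfth`), the printed side conditions on the prime by `decide`, and
   `r_an = 1 ∧ BSD(E,3)` from the partner-free consumers. The equations are identified with their
   conductor / isogeny class in the docstrings only (hyp's table; second engine PARI/GP, this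
   seat's `g24/cubesum_families/`); the theorems are about the explicit equations.

What this file does NOT do: no class label changes; nothing is booked (the lane books); no
statement about members of these isogeny classes other than the displayed equations is needed by
the isogeny-class theorems, but APPLYING them to another member needs that member's `ℚ`-isogeny as
a kernel term (Vélu `3`-isogenies as in gen 3's `isIsogenous_of_a₆`).

## References
* [KezukaLi2020] Y. Kezuka, Y. Li, Doc. Math. 25 (2020) 2115–2147, Cor. 1.2, (4.1).
* [HuShuYin2019] Y. Hu, J. Shu, H. Yin, Trans. AMS 372 (2019), Thm. 1.3, Thm. 1.4, p. 4.
* [ShuYin2022] J. Shu, H. Yin, Math. Ann. 385 (2023), Thm. 1.2.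
* [BurungaleFlach2024] A. Burungale, M. Flach, Camb. J. Math. 12 (2024), Cor. 2 (rank-zero CM partner).
* [SilvermanAEC2009] J. H. Silverman, *AEC* 2nd ed., VIII.8 Cor. 8.3 (global minimal models over `ℚ`;
  Néron 1964), VII.1 Remark 1.1, III.1.
* [MilneADT2006] J. S. Milne, *Arithmetic Duality Theorems*, Thm. I.7.3; J. W. S. Cassels, J. reine
  angew. Math. 217 (1965) (isogeny invariance of BSD).
* [KolyvaginEulerSystems1990]; [GrossZagier1986] (finiteness of `Ш` at analytic rank one).
* [Miller2011LMS] R. L. Miller, LMS J. Comput. Math. 14 (2011), Def. 1.1 (`BSD(E,p)`).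
* HOME/b2b-bsdres-hyp/hyp/ram3/RAM3-CENSUS.md §4–§5 (the 13 classes); HOME/REFEREE.md R65.1/R65.3;
  HOME/b2b-bsdres-harvest-1/RECLASSIFY.md §GEN-24.
-/

set_option autoImplicit false

noncomputable section

open scoped Classical

open WeierstrassCurve Literature.NumberTheory.EllipticCurves
  Literature.NumberTheory.EllipticCurves.Rank1Residual
  Literature.NumberTheory.EllipticCurves.HuShuYin2019
  Literature.NumberTheory.EllipticCurves.Rank1Residual.X12CubeSum

namespace Summit.BirchSwinnertonDyer.Rank1Residual.X12.CubeSumFamilies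

/-! ### §1. Generic steps: a globally minimal model exists; the family equations are elliptic -/

/-- **Every elliptic curve over `ℚ` is `ℚ`-isomorphic to a globally minimal Weierstrass equation**
(Néron 1964; Silverman *AEC* VIII.8 Cor. 8.3 — tree theorem `hasGlobalMinimalModel_rat_holds`),
in the shape the family facts consume: `∃ V` globally minimal elliptic with `C • V = W`.
[cite: SilvermanAEC2009, VIII.8 Cor. 8.3] -/
theorem exists_isGloballyMinimal_model (W : WeierstrassCurve ℚ) [W.IsElliptic] :
    ∃ (V : WeierstrassCurve ℚ) (_ : V.IsElliptic) (_ : V.IsGloballyMinimal),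
      ∃ C : VariableChange ℚ, C • V = W := by
  obtain ⟨C, hC⟩ := hasGlobalMinimalModel_rat_holds W
  exact ⟨C • W, inferInstance, hC, C⁻¹, inv_smul_smul C W⟩

/-- `cubeSumCurve n = [0, 0, 0, 0, −432 n²]` is elliptic for `n ≠ 0` (`Δ = −27·(4·a₆)² ≠ 0`).
[cite: SilvermanAEC2009, III.1] -/
theorem isElliptic_cubeSumCurve {n : ℚ} (hn : n ≠ 0) : (cubeSumCurve n).IsElliptic := by
  have h : (0 : ℚ) ^ 2 + 4 * (-432 * n ^ 2) ≠ 0 := by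
    have : n ^ 2 ≠ 0 := pow_ne_zero _ hn
    intro h0
    apply this
    linarith
  exact isElliptic_mk h

/-- Kezuka–Li's `cubeSumTwoModel p j = [0, 0, 0, 0, −27 p^{2j}]` is elliptic for `p ≠ 0`.
[cite: KezukaLi2020, (4.1) (p. 2139)] -/
theorem isElliptic_cubeSumTwoModel {p : ℕ} (hp : p ≠ 0) (j : ℕ) :
    (KezukaLi2020.cubeSumTwoModel p j).IsElliptic := by
  have h : (0 : ℚ) ^ 2 + 4 * (-27 * (p : ℚ) ^ (2 * j)) ≠ 0 := by
    have : (p : ℚ) ^ (2 * j) ≠ 0 := pow_ne_zero _ (Nat.cast_ne_zero.mpr hp)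
    intro h0
    apply this
    linarith
  exact isElliptic_mk h

/-- **The transport, packaged once**: if every globally minimal model `V'` `ℚ`-isomorphic to an
elliptic equation `W₀` satisfies `r_an(V') = 1 ∧ Ш(V') finite ∧ BSD(V',3)`, then so does (`r_an = 1 ∧
BSD(·,3)`) every globally minimal `V` `ℚ`-ISOGENOUS to `W₀` — via an existentially chosen globally
minimal model of `W₀` (`exists_isGloballyMinimal_model`) and Cassels' invariance
(`X12CubeSum.bsdp_three_of_isIsogenous`: `hCassels`, modularity `hmod` for `L'(V',1) ≠ 0`).
[cite: MilneADT2006, Thm. I.7.3] [cite: SilvermanAEC2009, VIII.8 Cor. 8.3] -/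
theorem bsdp_three_of_isIsogenous_of_forall_model (hCassels : bsdRHS_eq_of_isIsogenous)
    (hmod : hasEntireLFunction_rat) (W₀ : WeierstrassCurve ℚ) [W₀.IsElliptic]
    (H : ∀ (V' : WeierstrassCurve ℚ) [V'.IsElliptic] [V'.IsGloballyMinimal],
      (∃ C : VariableChange ℚ, C • V' = W₀) → V'.analyticRank = 1 ∧ Finite V'.sha ∧ BSDp V' 3)
    (V : WeierstrassCurve ℚ) [V.IsElliptic] [V.IsGloballyMinimal] (hiso : IsIsogenous V W₀) :
    V.analyticRank = 1 ∧ BSDp V 3 := by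
  obtain ⟨V', _, _, C, hC⟩ := exists_isGloballyMinimal_model W₀
  obtain ⟨hr, hfin, hb⟩ := H V' ⟨C, hC⟩
  have h1 : IsIsogenous W₀ V' := by
    rw [← hC]
    exact isIsogenous_of_smul V' C
  exact bsdp_three_of_isIsogenous hCassels hmod (hiso.trans' h1) hr hfin hb

/-! ### §2. Kezuka–Li 2020 Cor. 1.2 on the isogeny classes of `C_{2p}` (`p ≡ 2 mod 9`) and `C_{2p²}` (`p ≡ 5 mod 9`) -/

/-- **Kezuka–Li Cor. 1.2, isogeny-class form.** For an odd prime `p` with `p ≡ 2 (mod 9)` and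
`j = 1` (the binder `p ≠ 2` is the print's "odd": `2 ≡ 2 mod 9`), or `p ≡ 5 (mod 9)` and `j = 2`,
every globally minimal `V/ℚ` that is `ℚ`-isogenous to
`y² = x³ − 27 p^{2j}` (`C_{2p^j} : x³ + y³ = 2p^j`) has `r_an(V) = 1` and satisfies `BSD(V, 3)`.
Inputs: the family fact `hKL`, Cassels `hCassels`, modularity `hmod`.
[cite: KezukaLi2020, Cor. 1.2 (pp. 2116–2117)] [cite: MilneADT2006, Thm. I.7.3] -/
theorem bsdp_three_of_isIsogenous_cubeSumTwoModel (hKL : KezukaLi2020.cor12_threePart_of_cubeSum)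
    (hCassels : bsdRHS_eq_of_isIsogenous) (hmod : hasEntireLFunction_rat)
    {p j : ℕ} (hp : p.Prime) (hp2 : p ≠ 2) (hpj : (p % 9 = 2 ∧ j = 1) ∨ (p % 9 = 5 ∧ j = 2))
    (V : WeierstrassCurve ℚ) [V.IsElliptic] [V.IsGloballyMinimal]
    (hiso : IsIsogenous V (KezukaLi2020.cubeSumTwoModel p j)) :
    V.analyticRank = 1 ∧ BSDp V 3 := by
  haveI := isElliptic_cubeSumTwoModel hp.ne_zero j
  refine bsdp_three_of_isIsogenous_of_forall_model hCassels hmod _ (fun V' _ _ hV' ↦ ?_) V hiso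
  obtain ⟨-, hr, hfin, -⟩ := hKL p hp hp2 j hpj V' hV'
  exact ⟨hr, hfin, (KezukaLi2020.bsdp_three_of_cor12 hKL hp hp2 hpj V' hV').2⟩

/-! ### §3. Hu–Shu–Yin 2019 Thm. 1.4 (+ Burungale–Flach 2024): partner discharged; isogeny-class form -/

/-- **Hu–Shu–Yin Thm. 1.4 + Burungale–Flach, WITHOUT the partner binder.** For a prime
`p ≡ 4, 7 (mod 9)` with `3` not a cube mod `p`, every globally minimal `B ≅_ℚ E_p : y² = x³ − 432p²`
has `r_an(B) = 1`, `Ш(B)` finite and `BSD(B, 3)`; the globally minimal model of the rank-zero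
partner `E_{3p²}` that the Literature consumer `bsdp_three_of_thm14` asks for is supplied by
`exists_isGloballyMinimal_model`. [cite: HuShuYin2019, Thm. 1.3 and Thm. 1.4 (p. 3)] [cite: BurungaleFlach2024, Cor. 2] [cite: SilvermanAEC2009, VIII.8 Cor. 8.3] -/
theorem bsdp_three_of_thm14' (hHSY : thm14_threePart_product)
    (hCM0 : bsdTriple_of_hasCM_of_L_one_ne_zero) (hmod : hasEntireLFunction_rat)
    {p : ℕ} (hp : p.Prime) (h9 : p % 9 = 4 ∨ p % 9 = 7) (h3 : ¬ ∃ x : ZMod p, x ^ 3 = 3)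
    (B : WeierstrassCurve ℚ) [B.IsElliptic] [B.IsGloballyMinimal]
    (hB : ∃ C : VariableChange ℚ, C • B = cubeSumCurve (p : ℚ)) :
    B.analyticRank = 1 ∧ Finite B.sha ∧ BSDp B 3 := by
  have hn : (3 * (p : ℚ) ^ 2) ≠ 0 :=
    mul_ne_zero (by norm_num) (pow_ne_zero _ (Nat.cast_ne_zero.mpr hp.ne_zero))
  haveI := isElliptic_cubeSumCurve hn
  obtain ⟨A, _, _, CA, hA⟩ := exists_isGloballyMinimal_model (cubeSumCurve (3 * (p : ℚ) ^ 2))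
  obtain ⟨-, -, hfin, -⟩ := hHSY p hp h9 h3 A B hB ⟨CA, hA⟩
  obtain ⟨hr, hb⟩ := bsdp_three_of_thm14 hHSY hCM0 hmod hp h9 h3 A B hB ⟨CA, hA⟩
  exact ⟨hr, hfin, hb⟩

/-- **Hu–Shu–Yin Thm. 1.4, isogeny-class form.** Same hypotheses on `p`; every globally minimal
`V/ℚ` that is `ℚ`-isogenous to `E_p : y² = x³ − 432p²` has `r_an(V) = 1 ∧ BSD(V, 3)`.
[cite: HuShuYin2019, Thm. 1.4 (p. 3)] [cite: BurungaleFlach2024, Cor. 2] [cite: MilneADT2006, Thm. I.7.3] -/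
theorem bsdp_three_of_isIsogenous_sylvester (hHSY : thm14_threePart_product)
    (hCM0 : bsdTriple_of_hasCM_of_L_one_ne_zero) (hmod : hasEntireLFunction_rat)
    (hCassels : bsdRHS_eq_of_isIsogenous)
    {p : ℕ} (hp : p.Prime) (h9 : p % 9 = 4 ∨ p % 9 = 7) (h3 : ¬ ∃ x : ZMod p, x ^ 3 = 3)
    (V : WeierstrassCurve ℚ) [V.IsElliptic] [V.IsGloballyMinimal]
    (hiso : IsIsogenous V (cubeSumCurve (p : ℚ))) :
    V.analyticRank = 1 ∧ BSDp V 3 := by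
  haveI := isElliptic_cubeSumCurve (Nat.cast_ne_zero.mpr hp.ne_zero : (p : ℚ) ≠ 0)
  exact bsdp_three_of_isIsogenous_of_forall_model hCassels hmod _
    (fun V' _ _ hV' ↦ bsdp_three_of_thm14' hHSY hCM0 hmod hp h9 h3 V' hV') V hiso

/-! ### §4. Shu–Yin 2022 Thm. 1.2 (+ Burungale–Flach 2024): partner discharged; isogeny-class form -/

/-- **Shu–Yin Thm. 1.2 (`p ≡ 2 mod 9`) + Burungale–Flach, WITHOUT the partner binder**: every
globally minimal `B ≅_ℚ E_{3p²}` has `r_an(B) = 1 ∧ BSD(B, 3)` (the partner `E_p`'s globally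
minimal model exists). [cite: ShuYin2022, Thm. 1.2 (p. 1)] [cite: BurungaleFlach2024, Cor. 2] [cite: SilvermanAEC2009, VIII.8 Cor. 8.3] -/
theorem bsdp_three_of_thm12_two' (hSY : ShuYin2022.thm12_threePart_product)
    (hCM0 : bsdTriple_of_hasCM_of_L_one_ne_zero) (hmod : hasEntireLFunction_rat)
    {p : ℕ} (hp : p.Prime) (hp2 : p ≠ 2) (h9 : p % 9 = 2)
    (B : WeierstrassCurve ℚ) [B.IsElliptic] [B.IsGloballyMinimal]
    (hB : ∃ C : VariableChange ℚ, C • B = cubeSumCurve (3 * (p : ℚ) ^ 2)) :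
    B.analyticRank = 1 ∧ BSDp B 3 := by
  haveI := isElliptic_cubeSumCurve (Nat.cast_ne_zero.mpr hp.ne_zero : (p : ℚ) ≠ 0)
  obtain ⟨A, _, _, CA, hA⟩ := exists_isGloballyMinimal_model (cubeSumCurve (p : ℚ))
  exact ShuYin2022.bsdp_three_of_thm12_two hSY hCM0 hmod hp hp2 h9 A B ⟨CA, hA⟩ hB

/-- **Shu–Yin Thm. 1.2 (`p ≡ 5 mod 9`) + Burungale–Flach, WITHOUT the partner binder**: every
globally minimal `B ≅_ℚ E_{3p}` has `r_an(B) = 1 ∧ BSD(B, 3)` (the partner `E_{p²}`'s globally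
minimal model exists). [cite: ShuYin2022, Thm. 1.2 (p. 1)] [cite: BurungaleFlach2024, Cor. 2] [cite: SilvermanAEC2009, VIII.8 Cor. 8.3] -/
theorem bsdp_three_of_thm12_five' (hSY : ShuYin2022.thm12_threePart_product)
    (hCM0 : bsdTriple_of_hasCM_of_L_one_ne_zero) (hmod : hasEntireLFunction_rat)
    {p : ℕ} (hp : p.Prime) (h9 : p % 9 = 5)
    (B : WeierstrassCurve ℚ) [B.IsElliptic] [B.IsGloballyMinimal]
    (hB : ∃ C : VariableChange ℚ, C • B = cubeSumCurve (3 * (p : ℚ))) :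
    B.analyticRank = 1 ∧ BSDp B 3 := by
  have hn : ((p : ℚ) ^ 2) ≠ 0 := pow_ne_zero _ (Nat.cast_ne_zero.mpr hp.ne_zero)
  haveI := isElliptic_cubeSumCurve hn
  obtain ⟨A, _, _, CA, hA⟩ := exists_isGloballyMinimal_model (cubeSumCurve ((p : ℚ) ^ 2))
  exact ShuYin2022.bsdp_three_of_thm12_five hSY hCM0 hmod hp h9 A B ⟨CA, hA⟩ hB

/-- **Shu–Yin Thm. 1.2 (`p ≡ 2 mod 9`), isogeny-class form**: every globally minimal `V/ℚ`
`ℚ`-isogenous to `E_{3p²}` has `r_an(V) = 1 ∧ BSD(V, 3)`; `Ш` finite on the printed side (needed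
by Cassels' transport, not printed by Shu–Yin) from Gross–Zagier–Kolyvagin `hGZK` at analytic rank
one. [cite: ShuYin2022, Thm. 1.2 (p. 1)] [cite: BurungaleFlach2024, Cor. 2] [cite: MilneADT2006, Thm. I.7.3] [cite: KolyvaginEulerSystems1990] -/
theorem bsdp_three_of_isIsogenous_cubeSum_three_mul_sq (hSY : ShuYin2022.thm12_threePart_product)
    (hCM0 : bsdTriple_of_hasCM_of_L_one_ne_zero) (hmod : hasEntireLFunction_rat)
    (hCassels : bsdRHS_eq_of_isIsogenous) (hGZK : rank_eq_analyticRank_of_analyticRank_le_one)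
    {p : ℕ} (hp : p.Prime) (hp2 : p ≠ 2) (h9 : p % 9 = 2)
    (V : WeierstrassCurve ℚ) [V.IsElliptic] [V.IsGloballyMinimal]
    (hiso : IsIsogenous V (cubeSumCurve (3 * (p : ℚ) ^ 2))) :
    V.analyticRank = 1 ∧ BSDp V 3 := by
  have hn : (3 * (p : ℚ) ^ 2) ≠ 0 :=
    mul_ne_zero (by norm_num) (pow_ne_zero _ (Nat.cast_ne_zero.mpr hp.ne_zero))
  haveI := isElliptic_cubeSumCurve hn
  refine bsdp_three_of_isIsogenous_of_forall_model hCassels hmod _ (fun V' _ _ hV' ↦ ?_) V hiso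
  obtain ⟨hr, hb⟩ := bsdp_three_of_thm12_two' hSY hCM0 hmod hp hp2 h9 V' hV'
  exact ⟨hr, (hGZK V' (by rw [hr])).2, hb⟩

/-- **Shu–Yin Thm. 1.2 (`p ≡ 5 mod 9`), isogeny-class form**: every globally minimal `V/ℚ`
`ℚ`-isogenous to `E_{3p}` has `r_an(V) = 1 ∧ BSD(V, 3)` (`Ш` finite from `hGZK`).
[cite: ShuYin2022, Thm. 1.2 (p. 1)] [cite: BurungaleFlach2024, Cor. 2] [cite: MilneADT2006, Thm. I.7.3] [cite: KolyvaginEulerSystems1990] -/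
theorem bsdp_three_of_isIsogenous_cubeSum_three_mul (hSY : ShuYin2022.thm12_threePart_product)
    (hCM0 : bsdTriple_of_hasCM_of_L_one_ne_zero) (hmod : hasEntireLFunction_rat)
    (hCassels : bsdRHS_eq_of_isIsogenous) (hGZK : rank_eq_analyticRank_of_analyticRank_le_one)
    {p : ℕ} (hp : p.Prime) (h9 : p % 9 = 5)
    (V : WeierstrassCurve ℚ) [V.IsElliptic] [V.IsGloballyMinimal]
    (hiso : IsIsogenous V (cubeSumCurve (3 * (p : ℚ)))) :
    V.analyticRank = 1 ∧ BSDp V 3 := by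
  have hn : (3 * (p : ℚ)) ≠ 0 := mul_ne_zero (by norm_num) (Nat.cast_ne_zero.mpr hp.ne_zero)
  haveI := isElliptic_cubeSumCurve hn
  refine bsdp_three_of_isIsogenous_of_forall_model hCassels hmod _ (fun V' _ _ hV' ↦ ?_) V hiso
  obtain ⟨hr, hb⟩ := bsdp_three_of_thm12_five' hSY hCM0 hmod hp h9 V' hV'
  exact ⟨hr, (hGZK V' (by rw [hr])).2, hb⟩

end Summit.BirchSwinnertonDyer.Rank1Residual.X12.CubeSumFamilies

end
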